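import Mathlib

/-!
# Symmetrisation is value-neutral for invariant convex programs
(hub-lb · idea-1 g5 · lens «symmetry-adapted SDP hierarchies» · crux workfile for
`LowerEdge_ge_m4o5` / `LowerEdge_ge_m83o100`)

If a finite group `G` acts linearly on a real vector space `E`, a convex feasible set `F` is
`G`-stable and a linear objective `c` is `G`-invariant, then every feasible point has a `G`-FIXED
feasible point with the SAME objective value (group average).  Consequently the set of objective
values over `F` equals the set of objective values over the fixed-point slice `F ∩ Fix(G)`:
restricting a symmetric convex relaxation (moment/SOS SDP with D4 × SU(2) × U(1) × adjoint/reality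
invariant data) to symmetric, block-diagonalised pseudo-moments changes the COST of solving it,
never its VALUE.  Symmetry adaptation can neither raise nor lower a certified relaxation bound;
value can enter only through constraints that are NOT consequences of the relaxation's own cone
(ground-state selection theorems, deformed Hamiltonians as in `odd-deformation-eom-transfer`).

Source: [corpus: book:blekherman2012-semidefinite-optimization-convex-algebraic-geometry
pp. 102–103, §3.3.6 «Symmetries — Convexity», the group-average argument].
-/

namespace Summit.Ventures.CertifiedManyBodySolver.Cruxes.LowerEdge_ge_m4o5.SymNeutral

open Finset BigOperators

variable {E : Type*} [AddCommGroup E] [Module ℝ E]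
variable {G : Type*} [Group G] [Fintype G]

/-- The group average of `x` under a linear action `ρ` of a finite group. -/
noncomputable def groupAverage (ρ : G →* (E →ₗ[ℝ] E)) (x : E) : E :=
  (Fintype.card G : ℝ)⁻¹ • ∑ g : G, ρ g x

omit [Group G] in
private lemma card_pos_real [Nonempty G] : (0 : ℝ) < Fintype.card G := by
  exact_mod_cast Fintype.card_pos

/-- A `G`-stable convex set contains the group average of each of its points. -/
theorem groupAverage_mem (ρ : G →* (E →ₗ[ℝ] E)) {F : Set E}
    (hF : Convex ℝ F) (hGF : ∀ g : G, ∀ x ∈ F, ρ g x ∈ F) {x : E} (hx : x ∈ F) :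
    groupAverage ρ x ∈ F := by
  classical
  have hcard : (0 : ℝ) < Fintype.card G := by exact_mod_cast Fintype.card_pos
  have key := hF.sum_mem (t := (Finset.univ : Finset G))
    (w := fun _ : G => (Fintype.card G : ℝ)⁻¹) (z := fun g => ρ g x)
    (fun _ _ => by positivity)
    (by simp [Finset.sum_const, Finset.card_univ, hcard.ne'])
    (fun g _ => hGF g x hx)
  simpa [groupAverage, Finset.smul_sum] using key

/-- The group average is a fixed point of the action. -/
theorem groupAverage_fixed (ρ : G →* (E →ₗ[ℝ] E)) (x : E) (h : G) :
    ρ h (groupAverage ρ x) = groupAverage ρ x := by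
  classical
  unfold groupAverage
  rw [map_smul, map_sum]
  congr 1
  have : ∀ g : G, ρ h (ρ g x) = ρ (h * g) x := fun g => by
    rw [map_mul]; rfl
  simp_rw [this]
  exact Fintype.sum_equiv (Equiv.mulLeft h) _ _ (fun g => rfl)

/-- A `G`-invariant linear functional takes the same value on `x` and on its group average. -/
theorem objective_groupAverage (ρ : G →* (E →ₗ[ℝ] E)) (c : E →ₗ[ℝ] ℝ)
    (hc : ∀ g : G, ∀ x : E, c (ρ g x) = c x) (x : E) :
    c (groupAverage ρ x) = c x := by
  classical
  have hcard : (Fintype.card G : ℝ) ≠ 0 := by exact_mod_cast Fintype.card_ne_zero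
  unfold groupAverage
  rw [map_smul, map_sum]
  simp_rw [hc]
  simp [Finset.sum_const, Finset.card_univ, hcard]

/-- **Value neutrality of symmetrisation.**  For a `G`-invariant convex program, every feasible
point is matched by a `G`-fixed feasible point with the same objective value. -/
theorem exists_fixed_same_value (ρ : G →* (E →ₗ[ℝ] E)) {F : Set E} (hF : Convex ℝ F)
    (hGF : ∀ g : G, ∀ x ∈ F, ρ g x ∈ F) (c : E →ₗ[ℝ] ℝ)
    (hc : ∀ g : G, ∀ x : E, c (ρ g x) = c x) {x : E} (hx : x ∈ F) :
    ∃ y ∈ F, (∀ g : G, ρ g y = y) ∧ c y = c x :=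
  ⟨groupAverage ρ x, groupAverage_mem ρ hF hGF hx,
    fun g => groupAverage_fixed ρ x g, objective_groupAverage ρ c hc x⟩

/-- **Corollary (same value set, hence same infimum / same certified bound).**  The objective
values attained on the feasible set coincide with those attained on its fixed-point slice. -/
theorem value_set_eq_fixed_slice (ρ : G →* (E →ₗ[ℝ] E)) {F : Set E} (hF : Convex ℝ F)
    (hGF : ∀ g : G, ∀ x ∈ F, ρ g x ∈ F) (c : E →ₗ[ℝ] ℝ)
    (hc : ∀ g : G, ∀ x : E, c (ρ g x) = c x) :
    c '' F = c '' (F ∩ {y | ∀ g : G, ρ g y = y}) := by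
  apply Set.Subset.antisymm
  · rintro _ ⟨x, hx, rfl⟩
    obtain ⟨y, hyF, hfix, hval⟩ := exists_fixed_same_value ρ hF hGF c hc hx
    exact ⟨y, ⟨hyF, hfix⟩, hval⟩
  · exact Set.image_mono Set.inter_subset_left

/-- Same infimum: the relaxation value over all pseudo-moments equals the value over symmetric
(block-diagonalisable) pseudo-moments. -/
theorem sInf_eq_fixed_slice (ρ : G →* (E →ₗ[ℝ] E)) {F : Set E} (hF : Convex ℝ F)
    (hGF : ∀ g : G, ∀ x ∈ F, ρ g x ∈ F) (c : E →ₗ[ℝ] ℝ)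
    (hc : ∀ g : G, ∀ x : E, c (ρ g x) = c x) :
    sInf (c '' F) = sInf (c '' (F ∩ {y | ∀ g : G, ρ g y = y})) := by
  rw [value_set_eq_fixed_slice ρ hF hGF c hc]

end Summit.Ventures.CertifiedManyBodySolver.Cruxes.LowerEdge_ge_m4o5.SymNeutral
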